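import Literature.MathematicalPhysics.QuantumFieldTheory.Balaban1983to89.B5Hk103ScalarZd
import Summits.QuantumFields.BalabanUV.Beta.TameKernelCalculus

/-!
# `BalabanUV.Beta.D1BFx.GhostLeg` — road «BF-x» for binder row D1, typer object T2: THE SCALAR GHOST LEG `Ggh n a` IS THE
# WHOLE-LATTICE INVERSE KERNEL OF THE SCALAR TOWER OPERATOR `Δ^η + a·Q′*Q′` (mesh `η = 1/n`, block side `n`) READ AS A
# `Unit`-FIBRED KERNEL — re-indexing, the entrywise dictionary `(Δ^η + aQ′*Q′)·Ggh = 𝟙 = Ggh·(Δ^η + aQ′*Q′)`, symmetry, mesh-scaled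
# decay, tameness, row sums, block-translation covariance

HONEST FRAMING (cell contract, verbatim): «discharging `BetaPertH` makes Bałaban's UV stability UNCONDITIONAL — a real constructive-QFT
result; it is NOT the continuum limit and NOT the Clay problem.»  HONEST DEPENDENCY (verbatim): «continuum YM on T⁴ ⇐ BetaPertH ∧ nine
spine estimates (0/9 proved); BetaPertH ⇐ (D1) ∧ (D4) ∧ CAP+tail; G-an2-4 gates asym, D1 and NE2/3/4.»  THIS MODULE DISCHARGES NOTHING.
It is ONE DEFINITION-BY-RE-INDEXING over an object already in the tree (pv-lineage `B5Hk103ScalarZd.Gk`, the B4 Sect. 5 exhaustion-limit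
inverse kernel `limInv ℤ⁴ (B6QGQLower276.Aker m a)` of the site matrix of `Δ^η + aQ′*Q′`, `η = 1/(m+1)`) and the transfer of that lineage's
theorems to the road's `ExpKernelCalculus.MKer` currency; the only new argument is the [folklore] block-translation covariance of the
whole-lattice inverse (uniqueness of the bounded two-sided inverse, `B4Sect5Exhaustion.eq_limInv_of_right_inverse`).  No `Prop` is minted,
nothing printed is asserted or cited as a hypothesis, 0 sorry.  Staged by the D1 formalisation-swarm TYPER
(planner-b2b-balaban-beta-d1-formalise-typer-0; claim `LEAVES-BFx.md` row T2, 2026-08-20T06:24:48Z) for a prover-role courier.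
NOT summit progress; NOT BetaPertH, NOT continuum, NOT Clay.

ABSOLUTE RULE (cell, verbatim): «No internally-minted statement may enter as a cited fact. Every hypothesis is either kernel-proved in this
package or a verbatim quotation of a PUBLISHED theorem with page reference. The manuscript(s) under audit are NOT citable for their own
disputed steps — they are the thing under adjudication; programme-internal (2001/route/tribunal) claims are never citable.»

## WHY (skeleton `HOME/beta/skeletons/D1-b2b-balaban-beta-d1-p2.md` v1.4 node O2/R3/L5, typer spec `TYPER-SPEC-D1BFx.md` §1 T2)

In the REDUCED background-Feynman form (K-R2) of the first step at block `n` the three leg species are the gluon leg `Ga` (T1,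
`D1BFx/GluonLeg`), the coarse leg `Cun` (T3, `D1BFx/CoarseLeg`) and the GHOST leg `Ggh n := (Kgh n 1)⁻¹`, `Kgh n 1 = D*D + a·Q′_n*Q′_n` on
`𝔫`-valued scalars at `U = 1` (skeleton O2; CONTEXT ONLY: [Balaban1985BackgroundPropagators, (3.24) p. 395] — nothing printed is asserted).
At `U = 1` the colour structure is stripped (road convention, `StepJetData` §5) and the ghost operator is, per colour component, the SCALAR
tower operator, whose whole-lattice inverse kernel this lineage holds as `B5Hk103ScalarZd.Gk m a p q` (`= limInv ℤ^d (Aker m a) (p,0) (q,0)`,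
site matrix `AX m a = (m+1)²·(−Δ_sites) + a·(m+1)^{−d}·1[same block]`, block side `m + 1`).  THIS FILE TYPES `Ggh n a : MKer 4 Unit` for the
road's block size `n ≥ 1` (`m := n − 1`) and transports: the ENTRYWISE DICTIONARY (both one-sided inverse identities, T2's «`Ggh =
(Δ₀ + Q′*aQ′)⁻¹` entrywise»), symmetry, the mesh-scaled entry bound `|Ggh| ≤ (2/min(2,a))·e^{−δ_u(4,a)·|x−y|_∞/n}` (rate `∝ 1/n` exactly as
the gluon leg's), hence `Decays`/`Spr`/`Tame`/`Bdd` in the road's `ℓ¹` currency, the row sum `Σ_y Ggh x y = a⁻¹`, and block-translation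
covariance `shiftK (n•t) (Ggh n a) = Ggh n a` (the `covA` field of `ExpKernelCalculus.BlockCovariant`).

## CONTENTS (0 sorry)
§1 `Ggh`, `Ggh_apply`, index bookkeeping (`n − 1 + 1 = n`), the site matrix in road units `AX_pred_apply`, `blk_pred_apply` · §2 THE DICTIONARY
`sum_AX_mul_Ggh` / `tsum_AX_mul_Ggh` / `tsum_Ggh_mul_AX` · §3 `Ggh_symm`, `trK_Ggh` · §4 `abs_Ggh_le`, `l1_sub_le_four_mul_dist`, `decays_Ggh`,
`bdd_Ggh`, `spr_Ggh`, `tame_Ggh` · §5 `summable_Ggh_row`, `tsum_Ggh_row` · §6 [folklore, new argument] `lapDir/lapKer/blk/sameBlk/AX_translate`,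
**`Gk_translate`** (any `d = 4` block side), **`shiftK_Ggh`**.  NOT here: the colour multiplicity of the ghost loop (road's A-leaves), the
`U`-dependence / jets of `Kgh n U` (T6), any identification with a torus object (V1), any `n`-uniform bound beyond the displayed rate.
-/

namespace Summit.QuantumFields.BalabanUV.Beta.D1BFx.GhostLeg

open Literature.MathematicalPhysics.QuantumFieldTheory.Balaban1983to89
open Literature.MathematicalPhysics.QuantumFieldTheory.Balaban1983to89.Beta
open B12Sec2to5 (l1 l1_nonneg)
open B4Sect5Exhaustion (limInv limInv_symm eq_limInv_of_right_inverse)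
open B6QGQLower276 (X e side blk lapDir lapKer sameBlk AX Aker AX_symm hyp56Z_Aker c0 c0_pos)
open B6QGQDecay237 (deltaU deltaU_pos)
open B5Hk103ScalarZd (Gk toK nbhd abs_Gk_le sum_AX_mul_Gk tsum_AX_mul tsum_Gk_mul_AX tsum_Gk_row summable_Gk_row)
open ExpKernelCalculus (Site MKer Decays shiftK)
open KernelWard (Bdd)
open Summit.QuantumFields.BalabanUV.Beta.TameKernelCalculus (Spr Tame trK Spr.tame)

noncomputable section

/-! ## §1 The object -/

/-- [our object] **T2 — THE SCALAR GHOST LEG at block size `n`**: `Ggh n a x y () () := Gk (n − 1) a x y`, the whole-lattice inverse kernel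
of the site matrix `n²·(−Δ_sites) + a·n^{−4}·1[same n-block]` of `Δ^η + a·Q′*Q′` (`η = 1/n`) on `ℤ⁴`, in the road's `MKer 4 Unit` currency.
A DEFINITION (re-indexing of `B5Hk103ScalarZd.Gk`); asserts nothing. -/
def Ggh (n : ℕ) [NeZero n] (a : ℝ) : MKer 4 Unit := fun x y _ _ => Gk (d := 4) (n - 1) a x y

variable (n : ℕ) [NeZero n] (a : ℝ)

/-- [our object] Unfolding `Ggh`. -/
theorem Ggh_apply (x y : Site 4) (u v : Unit) : Ggh n a x y u v = Gk (d := 4) (n - 1) a x y := rfl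

/-- [folklore] Index bookkeeping: `n − 1 + 1 = n` for `n ≥ 1`. -/
theorem pred_add_one : n - 1 + 1 = n := Nat.sub_add_cancel NeZero.one_le

/-- [folklore] The same in `ℝ`: the lineage's mesh denominator `((n − 1 : ℕ) : ℝ) + 1` is the road's block size `n`. -/
theorem cast_pred_add_one : ((n - 1 : ℕ) : ℝ) + 1 = n := by
  rw [← Nat.cast_add_one, pred_add_one n]

/-- [folklore] The same in `ℤ`: the lineage's block side `side (n − 1)` is `n`. -/
theorem side_pred : side (n - 1) = (n : ℤ) := by
  have h := pred_add_one n
  unfold side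
  omega

/-- [folklore] The site matrix in road units: `AX (n−1) a p q = n²·(−Δ)(p,q) + a·n⁻⁴·1[blk p = blk q]`. -/
theorem AX_pred_apply (p q : X 4) :
    AX (n - 1) a p q = (n : ℝ) ^ 2 * lapKer p q + a / (n : ℝ) ^ 4 * sameBlk (n - 1) p q := by
  simp only [AX, cast_pred_add_one n]

/-- [folklore] Block labels in road units: `blk (n−1) p μ = p μ / n` (floor division by the block side `n`). -/
theorem blk_pred_apply (p : X 4) (μ : Fin 4) : blk (n - 1) p μ = p μ / (n : ℤ) := by
  show p μ / side (n - 1) = _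
  rw [side_pred]

/-! ## §2 The dictionary: `Ggh n a` is THE two-sided inverse kernel of `Δ^η + a·Q′*Q′` on `ℤ⁴`, entrywise -/

/-- [folklore] **`(Δ^η + aQ′*Q′)·Ggh = 𝟙` entrywise**, finite-row form: `Σ_{r ∈ nbhd} AX(x,r)·Ggh(r,y) = δ_{xy}`
(`B5Hk103ScalarZd.sum_AX_mul_Gk` BY NAME). -/
theorem sum_AX_mul_Ggh (ha : 0 < a) (x y : Site 4) (u v : Unit) :
    ∑ r ∈ nbhd (n - 1) x, AX (n - 1) a x r * Ggh n a r y u v = if x = y then 1 else 0 :=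
  sum_AX_mul_Gk (n - 1) ha x y

/-- [folklore] The same with the series over the middle index. -/
theorem tsum_AX_mul_Ggh (ha : 0 < a) (x y : Site 4) (u v : Unit) :
    ∑' r : Site 4, AX (n - 1) a x r * Ggh n a r y u v = if x = y then 1 else 0 := by
  simp only [Ggh_apply]
  rw [tsum_AX_mul (n - 1) a x (fun r => Gk (d := 4) (n - 1) a r y)]
  exact sum_AX_mul_Gk (n - 1) ha x y

/-- [folklore] **`Ggh·(Δ^η + aQ′*Q′) = 𝟙` entrywise**: `Σ'_r Ggh(x,r)·AX(r,y) = δ_{xy}` (`B5Hk103ScalarZd.tsum_Gk_mul_AX` BY NAME). -/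
theorem tsum_Ggh_mul_AX (ha : 0 < a) (x y : Site 4) (u v : Unit) :
    ∑' r : Site 4, Ggh n a x r u v * AX (n - 1) a r y = if x = y then 1 else 0 :=
  tsum_Gk_mul_AX (n - 1) ha x y

/-! ## §3 Symmetry -/

/-- [folklore] `Ggh n a x y = Ggh n a y x` (`B4Sect5Exhaustion.limInv_symm` for the symmetric site matrix). -/
theorem Ggh_symm (ha : 0 < a) (x y : Site 4) (u v : Unit) : Ggh n a x y u v = Ggh n a y x v u := by
  simp only [Ggh_apply]
  exact limInv_symm (lt_min two_pos ha) (c0_pos 4 (n - 1) ha.ne') one_pos (hyp56Z_Aker (d := 4) (n - 1) a) (x, 0) (y, 0)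

/-- [folklore] `trK (Ggh n a) = Ggh n a`. -/
theorem trK_Ggh (ha : 0 < a) : trK (Ggh n a) = Ggh n a := by
  funext x y u v
  exact (Ggh_symm n a ha x y u v).symm

/-! ## §4 Mesh-scaled decay, boundedness, tameness -/

/-- [folklore] **THE ENTRY BOUND** `|Ggh n a x y| ≤ (2/min(2,a))·e^{−δ_u(4,a)·|x − y|_∞/n}` (`B5Hk103ScalarZd.abs_Gk_le` BY NAME; the rate
scales like `1/n`, as the gluon leg's). -/
theorem abs_Ggh_le (ha : 0 < a) (x y : Site 4) (u v : Unit) :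
    |Ggh n a x y u v| ≤ 2 / min 2 a * Real.exp (-(deltaU 4 a * (dist x y / (n : ℝ)))) := by
  have h := abs_Gk_le (d := 4) (n - 1) ha x y
  rw [cast_pred_add_one n] at h
  exact h

/-- [folklore] `ℓ¹ ≤ 4·sup` on `ℤ⁴`: `|x − y|₁ ≤ 4·dist x y`. -/
theorem l1_sub_le_four_mul_dist (x y : Site 4) : l1 (x - y) ≤ 4 * dist x y := by
  have h : ∀ μ : Fin 4, |(((x - y) μ : ℤ) : ℝ)| ≤ dist x y := fun μ => by
    have h1 := dist_le_pi_dist x y μ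
    rw [Int.dist_eq] at h1
    simpa only [Pi.sub_apply, Int.cast_sub] using h1
  calc l1 (x - y) = ∑ μ : Fin 4, |(((x - y) μ : ℤ) : ℝ)| := rfl
    _ ≤ ∑ _μ : Fin 4, dist x y := Finset.sum_le_sum fun μ _ => h μ
    _ = 4 * dist x y := by simp

/-- [folklore] The constant `2/min(2,a)` is nonnegative for `a > 0`. -/
theorem const_nonneg (ha : 0 < a) : 0 ≤ 2 / min 2 a :=
  div_nonneg zero_le_two (le_min zero_le_two ha.le)

/-- [folklore] **`Decays (Ggh n a) (2/min(2,a)) (δ_u(4,a)/(4n))`** in the road's `ℓ¹` currency. -/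
theorem decays_Ggh (ha : 0 < a) : Decays (Ggh n a) (2 / min 2 a) (deltaU 4 a / (4 * n)) := by
  intro x y u v
  have hn : (0 : ℝ) < n := Nat.cast_pos.2 (Nat.pos_of_ne_zero (NeZero.ne n))
  have hδ : 0 ≤ deltaU 4 a := (deltaU_pos 4 ha).le
  have h4 : l1 (x - y) / 4 ≤ dist x y := by
    have := l1_sub_le_four_mul_dist x y
    linarith
  have key : deltaU 4 a / (4 * n) * l1 (x - y) ≤ deltaU 4 a * (dist x y / (n : ℝ)) := by
    rw [show deltaU 4 a / (4 * n) * l1 (x - y) = deltaU 4 a * ((l1 (x - y) / 4) * (n : ℝ)⁻¹) by ring,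
      div_eq_mul_inv (dist x y)]
    exact mul_le_mul_of_nonneg_left (mul_le_mul_of_nonneg_right h4 (inv_nonneg.2 hn.le)) hδ
  refine (abs_Ggh_le n a ha x y u v).trans (mul_le_mul_of_nonneg_left (Real.exp_le_exp.2 ?_) (const_nonneg a ha))
  rw [neg_mul]
  exact neg_le_neg key

/-- [folklore] `Bdd (Ggh n a) (2/min(2,a))`. -/
theorem bdd_Ggh (ha : 0 < a) : Bdd (Ggh n a) (2 / min 2 a) := by
  intro x y u v
  refine (abs_Ggh_le n a ha x y u v).trans (mul_le_of_le_one_right (const_nonneg a ha) ?_)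
  rw [Real.exp_le_one_iff, neg_nonpos]
  have := deltaU_pos 4 ha
  positivity

/-- [folklore] `Ggh n a` is a SPREAD kernel (`TameKernelCalculus.Spr`). -/
theorem spr_Ggh (ha : 0 < a) : Spr (Ggh n a) :=
  ⟨2 / min 2 a, deltaU 4 a / (4 * n), div_pos (deltaU_pos 4 ha)
    (mul_pos four_pos (Nat.cast_pos.2 (Nat.pos_of_ne_zero (NeZero.ne n)))), decays_Ggh n a ha⟩

/-- [folklore] `Ggh n a` is TAME. -/
theorem tame_Ggh (ha : 0 < a) : Tame (Ggh n a) := (spr_Ggh n a ha).tame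

/-! ## §5 Row sums -/

/-- [folklore] The rows of `Ggh n a` are summable. -/
theorem summable_Ggh_row (ha : 0 < a) (x : Site 4) (u v : Unit) : Summable fun y : Site 4 => Ggh n a x y u v :=
  summable_Gk_row (n - 1) ha x

/-- [folklore] **`Ggh·1 = a⁻¹`**: `Σ'_y Ggh n a x y = 1/a` (`B5Hk103ScalarZd.tsum_Gk_row` BY NAME). -/
theorem tsum_Ggh_row (ha : 0 < a) (x : Site 4) (u v : Unit) : ∑' y : Site 4, Ggh n a x y u v = 1 / a :=
  tsum_Gk_row (n - 1) ha x

/-! ## §6 Block-translation covariance [folklore; the one new argument of this file] -/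

/-- [folklore] The directional second difference is translation invariant. -/
theorem lapDir_translate (μ : Fin 4) (p q v : X 4) : lapDir μ (p + v) (q + v) = lapDir μ p q := by
  simp only [lapDir, add_right_comm p v (e μ), add_sub_right_comm p v (e μ), add_left_inj]

/-- [folklore] The lattice Laplacian kernel is translation invariant. -/
theorem lapKer_translate (p q v : X 4) : lapKer (p + v) (q + v) = lapKer p q := by
  simp only [lapKer, lapDir_translate]

/-- [folklore] Block labels shift by `t` under a translation by `side m • t`. -/
theorem blk_translate (m : ℕ) (p t : X 4) : blk m (p + side m • t) = blk m p + t := by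
  funext μ
  have hs : side m ≠ 0 := ne_of_gt (B6QGQLower276.side_facts m).1
  show (p + side m • t) μ / side m = p μ / side m + t μ
  rw [Pi.add_apply, Pi.smul_apply, smul_eq_mul, mul_comm, Int.add_mul_ediv_right _ _ hs]

/-- [folklore] The same-block indicator is invariant under block-lattice translations. -/
theorem sameBlk_translate (m : ℕ) (p q t : X 4) : sameBlk m (p + side m • t) (q + side m • t) = sameBlk m p q := by
  simp only [sameBlk, blk_translate, add_left_inj]

/-- [folklore] The site matrix of `Δ^η + aQ′*Q′` is invariant under block-lattice translations. -/
theorem AX_translate (m : ℕ) (p q t : X 4) : AX m a (p + side m • t) (q + side m • t) = AX m a p q := by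
  simp only [AX, lapKer_translate, sameBlk_translate]

/-- [folklore] **BLOCK-TRANSLATION COVARIANCE OF THE WHOLE-LATTICE INVERSE** `Gk m a (p + side m•t) (q + side m•t) = Gk m a p q`:
the translated kernel is again a bounded right inverse of the (translation-invariant) site matrix, and the bounded inverse kernel on
`ℤ⁴` is unique (`B4Sect5Exhaustion.eq_limInv_of_right_inverse`). -/
theorem Gk_translate (m : ℕ) (ha : 0 < a) (t p q : X 4) :
    Gk (d := 4) m a (p + side m • t) (q + side m • t) = Gk (d := 4) m a p q := by
  have hγ : 0 < min 2 a := lt_min two_pos ha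
  have hc : 0 < c0 4 m a := c0_pos 4 m ha.ne'
  have hbd : ∀ p' q' : B4Sect5Exhaustion.K 4 1,
      |Gk (d := 4) m a (p'.1 + side m • t) (q'.1 + side m • t)| ≤ 2 / min 2 a := fun p' q' => by
    refine (abs_Gk_le m ha _ _).trans (mul_le_of_le_one_right (const_nonneg a ha) ?_)
    rw [Real.exp_le_one_iff, neg_nonpos]
    have := deltaU_pos 4 ha
    positivity
  have hinv : ∀ p' r' : B4Sect5Exhaustion.K 4 1, p'.1 ∈ (Set.univ : Set (X 4)) → r'.1 ∈ (Set.univ : Set (X 4)) →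
      ∑' q' : B4Sect5Exhaustion.K 4 1, Aker m a p' q' * Gk (d := 4) m a (q'.1 + side m • t) (r'.1 + side m • t)
        = if p' = r' then 1 else 0 := by
    intro p' r' _ _
    have h1 : ∑' q' : B4Sect5Exhaustion.K 4 1, Aker m a p' q' * Gk (d := 4) m a (q'.1 + side m • t) (r'.1 + side m • t)
        = ∑' x : X 4, AX m a p'.1 x * Gk (d := 4) m a (x + side m • t) (r'.1 + side m • t) := by
      rw [← Equiv.tsum_eq (toK (d := 4))]
      rfl
    have h2 : ∀ x : X 4, AX m a p'.1 x * Gk (d := 4) m a (x + side m • t) (r'.1 + side m • t)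
        = AX m a (p'.1 + side m • t) (x + side m • t) * Gk (d := 4) m a (x + side m • t) (r'.1 + side m • t) :=
      fun x => by rw [AX_translate]
    have h3 : ∑' x : X 4, AX m a (p'.1 + side m • t) (x + side m • t) * Gk (d := 4) m a (x + side m • t) (r'.1 + side m • t)
        = ∑' y : X 4, AX m a (p'.1 + side m • t) y * Gk (d := 4) m a y (r'.1 + side m • t) :=
      (Equiv.addRight (side m • t)).tsum_eq (fun y => AX m a (p'.1 + side m • t) y * Gk (d := 4) m a y (r'.1 + side m • t))
    rw [h1, tsum_congr h2, h3, tsum_AX_mul m a (p'.1 + side m • t) (fun y => Gk (d := 4) m a y (r'.1 + side m • t)),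
      sum_AX_mul_Gk m ha]
    have hiff : p'.1 + side m • t = r'.1 + side m • t ↔ p' = r' := by
      rw [add_left_inj]
      exact ⟨fun h => Prod.ext h (Subsingleton.elim _ _), fun h => by rw [h]⟩
    simp only [hiff]
  exact eq_limInv_of_right_inverse hγ hc one_pos (hyp56Z_Aker (d := 4) m a)
    (D := fun p' q' : B4Sect5Exhaustion.K 4 1 => Gk (d := 4) m a (p'.1 + side m • t) (q'.1 + side m • t))
    (M := 2 / min 2 a) hbd (fun p' q' h => absurd (Set.mem_univ _) h) hinv (p := (p, 0)) (s := (q, 0))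
    (Set.mem_univ _) (Set.mem_univ _)

/-- [folklore] **BLOCK-TRANSLATION COVARIANCE OF THE GHOST LEG**: `shiftK (n•t) (Ggh n a) = Ggh n a` for every `t ∈ ℤ⁴` — the `covA`
field of `ExpKernelCalculus.BlockCovariant` at period `n`. -/
theorem shiftK_Ggh (ha : 0 < a) (t : Site 4) : shiftK ((n : ℤ) • t) (Ggh n a) = Ggh n a := by
  funext x y u v
  simp only [shiftK, Ggh_apply]
  have h := Gk_translate a (n - 1) ha t x y
  rw [side_pred] at h
  exact h

/-- [folklore] The same with the opposite sign of the shift. -/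
theorem shiftK_Ggh_neg (ha : 0 < a) (t : Site 4) : shiftK (-((n : ℤ) • t)) (Ggh n a) = Ggh n a := by
  rw [← smul_neg]
  exact shiftK_Ggh n a ha (-t)

end

end Summit.QuantumFields.BalabanUV.Beta.D1BFx.GhostLeg
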